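import Summits.KontsevichZagierPeriods.KontsevichZagierPeriods.Theorems.SymplecticScissorsRealOnePeriodRelationsStubArcSymbolsCut
import Summits.KontsevichZagierPeriods.KontsevichZagierPeriods.Theorems.SymplecticScissorsRealOnePeriodRelationsStubArcSymbolsFlatten
import Summits.KontsevichZagierPeriods.KontsevichZagierPeriods.Theorems.SymplecticScissorsRealOnePeriodRelationsStubArcSymbolsAux2
import Summits.KontsevichZagierPeriods.KontsevichZagierPeriods.Theorems.SymplecticScissorsCurvePeriodsTransferStubSaPieceFacts

/-!
# `RealOnePeriodRelations` (stmt-KontsevichZagierPeriods-10042), line `nash-retraction-thin-strip`: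
# stub `stub_arcSymbols`, auxiliary file 7 — the piece reduction of a representation on the unit
# interval, and `stub_arcSymbols` modulo the normalised Puiseux germ

PIECE REDUCTION of a representation `ρ = [∫_{(0,1)} h]`: cut `(0,1)` at the finitely many algebraic
break points of the `ℚ`-semialgebraic integrand `h` (`CurvePeriodsTransfer.stub_saPieceFacts` of the
sibling crux stmt-11129: off them `h` is analytic and an étale branch of a plane curve over `ℚ̄`, with
algebraic values at algebraic points) and at the mid-points of the cells (rule 1a,
`ArcSymbols.exists_cells`, `ArcSymbols.cut_split`), and flatten each half-cell at its bad end
(rule 2 + Puiseux, `ArcSymbols.flatten`). Hence, GRANTED the normalised Puiseux germ `hPG` (= the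
registered statement `CurvePeriodsTransfer.stub_puiseuxGerm` of stmt-11129), `ρ` is normalised by
`ArcSymbols.arcSymbols_of_pieces`: this is `arcSymbols_of_germ`, i.e. `stub_arcSymbols` with `hPG` as
its only remaining hypothesis.

References: M. Kontsevich, D. Zagier, *Periods* (2001), §1.2; A. Huber, G. Wüstholz, *Transcendence
and Linear Relations of 1-Periods* (2022), Prop. 12.5; J. Bochnak, M. Coste, M.-F. Roy, *Real Algebraic
Geometry* (1998), §2, §8.1.
-/

noncomputable section

open scoped BigOperators Topology
open Set MeasureTheory Filter MvPolynomial
open Literature.NumberTheory.Transcendental Literature.NumberTheory.Transcendental.CurvePeriods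
open Literature.ModelTheory.ExponentialFields (IsSemialgebraic)
open Summit.KontsevichZagierPeriods.SymplecticScissors.RealOnePeriodRelationsNegative (M₁)
open Summit.KontsevichZagierPeriods.SymplecticScissors.CurvePeriodsTransfer (stub_saPieceFacts)

namespace Summit.KontsevichZagierPeriods.SymplecticScissors.RealOnePeriodRelations

namespace ArcSymbols

/-! ## One half-cell -/

/-- **Flattening one half-cell of a representation on `(0,1)`.** For `ρ = [∫_{(0,1)} h]`, a cell
`(u, v) ⊆ (0, 1)` on which `h` is analytic and an étale branch of `P = 0` with algebraic values at
algebraic points, and a half-cell `{p + σCt | t ∈ (0,1]} ⊆ (u, v)` (`p`, `C` algebraic, `C > 0`,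
`σ = ±1`) whose open part is `(lo, hi)`, the cut `cut ρ lo hi` pulls back to a standard piece (granted
the Puiseux germ `hPG`). [cite: KontsevichZagier2001, §1.2 rule (2)] -/
theorem halfCell
    (hPG : ∀ (f : ℝ → ℝ) (a δ : ℝ), IsAlgebraic ℚ a → 0 < δ →
      IsSemialgebraicFunOn ℚ {z : Fin 1 → ℝ | z 0 ∈ Set.Ioo a (a + δ)} (fun z => f (z 0)) →
      ∃ (q : ℕ) (m : ℤ) (h : ℝ → ℝ), 0 < q ∧ AnalyticAt ℝ h 0 ∧ (∀ n, IsAlgebraic ℚ (iteratedDeriv n h 0)) ∧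
        (h 0 ≠ 0 ∨ ∀ s, h s = 0) ∧ ∀ᶠ s in 𝓝[>] (0 : ℝ), f (a + s ^ q) = s ^ m * h s)
    (ρ : KZ.IntegralRep 1) (hdom : ρ.domain = {z : Fin 1 → ℝ | z 0 ∈ Set.Ioo (0 : ℝ) 1})
    (P : MvPolynomial (Fin 2) ℝ) (hP : ∀ e, IsAlgebraic ℚ (P.coeff e)) {u v : ℝ}
    (hcell : ∀ x ∈ Set.Ioo u v, AnalyticAt ℝ (fun t => ρ.integrand fun _ => t) x ∧
      MvPolynomial.eval ![x, ρ.integrand fun _ => x] P = 0 ∧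
      MvPolynomial.eval ![x, ρ.integrand fun _ => x] (MvPolynomial.pderiv 1 P) ≠ 0 ∧
      (IsAlgebraic ℚ x → IsAlgebraic ℚ (ρ.integrand fun _ => x)))
    (huv01 : Set.Ioo u v ⊆ Set.Ioo 0 1)
    (p C σ : ℝ) (hp : IsAlgebraic ℚ p) (hC : 0 < C) (hCa : IsAlgebraic ℚ C) (hσ : σ = 1 ∨ σ = -1)
    (hseg : ∀ t ∈ Set.Ioc (0 : ℝ) 1, p + σ * C * t ∈ Set.Ioo u v)
    (lo hi : ℝ) (hlo : IsAlgebraic ℚ lo) (hhi : IsAlgebraic ℚ hi) (hlohi : Set.Ioo lo hi ⊆ Set.Ioo u v)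
    (himg : (fun y => p + σ * C * y) '' Set.Ioo (0 : ℝ) 1 = Set.Ioo lo hi) :
    ∃ (g : ℝ → ℝ) (G : MvPolynomial (Fin 2) ℝ) (R : KZ.IntegralRep 1),
      ((∀ e, IsAlgebraic ℚ (G.coeff e)) ∧ (∀ s ∈ Set.Icc (0 : ℝ) 1, AnalyticAt ℝ g s) ∧
        (∀ n, IsAlgebraic ℚ (iteratedDeriv n g 0)) ∧ IsAlgebraic ℚ (g 1) ∧
        IsSemialgebraicFunOn ℚ {z : Fin 1 → ℝ | z 0 ∈ Set.Icc (0 : ℝ) 1} (fun z => g (z 0)) ∧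
        (∀ s ∈ Set.Icc (0 : ℝ) 1, MvPolynomial.eval ![s, g s] G = 0) ∧
        (∀ s ∈ Set.Ioc (0 : ℝ) 1, MvPolynomial.eval ![s, g s] (MvPolynomial.pderiv 1 G) ≠ 0)) ∧
      (R.domain = {z : Fin 1 → ℝ | z 0 ∈ Set.Ioo (0 : ℝ) 1} ∧ ∀ z ∈ R.domain, R.integrand z = g (z 0)) ∧
      KZ.of R - KZ.of (cut ρ lo hi) ∈ KZ.changeOfVariablesRel := by
  set h : ℝ → ℝ := fun t => ρ.integrand fun _ => t with hh
  have hσa : IsAlgebraic ℚ σ := by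
    rcases hσ with h' | h' <;> rw [h']
    · exact isAlgebraic_one
    · exact isAlgebraic_one.neg
  have hhz : ∀ z : Fin 1 → ℝ, ρ.integrand z = h (z 0) := fun z => by
    rw [hh]
    show ρ.integrand z = ρ.integrand fun _ => z 0
    congr 1
    funext i
    rw [Fin.fin_one_eq_zero i]
  -- semialgebraicity of `h` on `(0,1)` and of `y ↦ h (p + σ C y)`
  have hU : IsSemialgebraic ℚ {z : Fin 1 → ℝ | z 0 ∈ Set.Ioo (0 : ℝ) 1} := isSemialgebraic_unitIoo
  have hsa_h : IsSemialgebraicFunOn ℚ {z : Fin 1 → ℝ | z 0 ∈ Set.Ioo (0 : ℝ) 1} (fun z => h (z 0)) := by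
    have h1 := ρ.isSemialgebraicFunOn_integrand
    rw [hdom] at h1
    exact h1.congr fun z _ => hhz z
  have hsa : IsSemialgebraicFunOn ℚ {z : Fin 1 → ℝ | z 0 ∈ Set.Ioo (0 : ℝ) 1}
      (fun z => h (p + σ * C * z 0)) := by
    have hX : IsSemialgebraicFunOn ℚ {z : Fin 1 → ℝ | z 0 ∈ Set.Ioo (0 : ℝ) 1} (fun z => z 0) :=
      (isSemialgebraicFunOn_aeval hU (MvPolynomial.X 0)).congr fun z _ => by simp
    have haff : IsSemialgebraicFunOn ℚ {z : Fin 1 → ℝ | z 0 ∈ Set.Ioo (0 : ℝ) 1}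
        (fun z => p + σ * C * z 0) :=
      (isSemialgebraicFunOn_const_of_isAlgebraic hU hp).fun_add
        (((isSemialgebraicFunOn_const_of_isAlgebraic hU hσa).fun_mul
          (isSemialgebraicFunOn_const_of_isAlgebraic hU hCa)).fun_mul hX)
    have hmap : IsSemialgebraicMapOn ℚ {z : Fin 1 → ℝ | z 0 ∈ Set.Ioo (0 : ℝ) 1}
        (fun z : Fin 1 → ℝ => fun _ : Fin 1 => p + σ * C * z 0) :=
      IsSemialgebraicMapOn.of_forall hU fun _ => haff
    have hmaps : MapsTo (fun z : Fin 1 → ℝ => fun _ : Fin 1 => p + σ * C * z 0)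
        {z : Fin 1 → ℝ | z 0 ∈ Set.Ioo (0 : ℝ) 1} {z : Fin 1 → ℝ | z 0 ∈ Set.Ioo (0 : ℝ) 1} :=
      fun z hz => huv01 (hseg (z 0) ⟨hz.1, hz.2.le⟩)
    exact (IsSemialgebraicFunOn.comp_isSemialgebraicMapOn_holds hsa_h hmap hmaps).congr
      fun z _ => rfl
  -- the cut representation of the half-cell
  have hcutdom : (cut ρ lo hi).domain =
      {z : Fin 1 → ℝ | z 0 ∈ (fun y => p + σ * C * y) '' Set.Ioo (0 : ℝ) 1} := by
    rw [cut_domain ρ hlo hhi, hdom, himg]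
    ext z
    simp only [Set.mem_inter_iff, Set.mem_setOf_eq]
    exact ⟨fun hz => hz.2, fun hz => ⟨huv01 (hlohi hz), hz⟩⟩
  have hcutint : ∀ z ∈ (cut ρ lo hi).domain, (cut ρ lo hi).integrand z = h (z 0) := fun z _ => by
    rw [cut_integrand ρ hlo hhi, hhz]
  have halg1 : IsAlgebraic ℚ (h (p + σ * C)) := by
    have hmem : p + σ * C * 1 ∈ Set.Ioo u v := hseg 1 ⟨one_pos, le_rfl⟩
    rw [mul_one] at hmem
    exact (hcell _ hmem).2.2.2 (hp.add (hσa.mul hCa))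
  exact flatten hPG h P hP p C σ hp hC hCa hσ (fun t ht => (hcell _ (hseg t ht)).1)
    (fun t ht => (hcell _ (hseg t ht)).2.1) (fun t ht => (hcell _ (hseg t ht)).2.2.1) halg1 hsa
    (cut ρ lo hi) hcutdom hcutint

/-! ## One cell -/

/-- **The two standard pieces of a cell.** For `ρ = [∫_{(0,1)} h]` and a cell `(u, v) ⊆ (0,1)` with
algebraic ends on which `h` is analytic and an étale branch of `P = 0` (algebraic values at algebraic
points), `cut ρ u v ≡ [∫_{(0,1)} g_L] + [∫_{(0,1)} g_R]` modulo `closure (1a ∪ 2)` with standard pieces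
`(g_L, G_L)`, `(g_R, G_R)`: cut at the mid-point (1a) and flatten both halves at their outer ends
(rule 2 + Puiseux). [cite: KontsevichZagier2001, §1.2] -/
theorem cell_pieces
    (hPG : ∀ (f : ℝ → ℝ) (a δ : ℝ), IsAlgebraic ℚ a → 0 < δ →
      IsSemialgebraicFunOn ℚ {z : Fin 1 → ℝ | z 0 ∈ Set.Ioo a (a + δ)} (fun z => f (z 0)) →
      ∃ (q : ℕ) (m : ℤ) (h : ℝ → ℝ), 0 < q ∧ AnalyticAt ℝ h 0 ∧ (∀ n, IsAlgebraic ℚ (iteratedDeriv n h 0)) ∧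
        (h 0 ≠ 0 ∨ ∀ s, h s = 0) ∧ ∀ᶠ s in 𝓝[>] (0 : ℝ), f (a + s ^ q) = s ^ m * h s)
    (ρ : KZ.IntegralRep 1) (hdom : ρ.domain = {z : Fin 1 → ℝ | z 0 ∈ Set.Ioo (0 : ℝ) 1})
    (P : MvPolynomial (Fin 2) ℝ) (hP : ∀ e, IsAlgebraic ℚ (P.coeff e)) {u v : ℝ}
    (hu : IsAlgebraic ℚ u) (hv : IsAlgebraic ℚ v) (huv : u < v) (huv01 : Set.Ioo u v ⊆ Set.Ioo 0 1)
    (hcell : ∀ x ∈ Set.Ioo u v, AnalyticAt ℝ (fun t => ρ.integrand fun _ => t) x ∧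
      MvPolynomial.eval ![x, ρ.integrand fun _ => x] P = 0 ∧
      MvPolynomial.eval ![x, ρ.integrand fun _ => x] (MvPolynomial.pderiv 1 P) ≠ 0 ∧
      (IsAlgebraic ℚ x → IsAlgebraic ℚ (ρ.integrand fun _ => x))) :
    ∃ (g : Bool → ℝ → ℝ) (G : Bool → MvPolynomial (Fin 2) ℝ) (R : Bool → KZ.IntegralRep 1),
      (∀ b, (∀ e, IsAlgebraic ℚ ((G b).coeff e)) ∧ (∀ s ∈ Set.Icc (0 : ℝ) 1, AnalyticAt ℝ (g b) s) ∧
        (∀ n, IsAlgebraic ℚ (iteratedDeriv n (g b) 0)) ∧ IsAlgebraic ℚ ((g b) 1) ∧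
        IsSemialgebraicFunOn ℚ {z : Fin 1 → ℝ | z 0 ∈ Set.Icc (0 : ℝ) 1} (fun z => (g b) (z 0)) ∧
        (∀ s ∈ Set.Icc (0 : ℝ) 1, MvPolynomial.eval ![s, (g b) s] (G b) = 0) ∧
        (∀ s ∈ Set.Ioc (0 : ℝ) 1, MvPolynomial.eval ![s, (g b) s] (MvPolynomial.pderiv 1 (G b)) ≠ 0)) ∧
      (∀ b, (R b).domain = {z : Fin 1 → ℝ | z 0 ∈ Set.Ioo (0 : ℝ) 1} ∧
        ∀ z ∈ (R b).domain, (R b).integrand z = g b (z 0)) ∧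
      KZ.of (cut ρ u v) - ∑ b, KZ.of (R b) ∈ AddSubgroup.closure (KZ.domainAddRel ∪ KZ.changeOfVariablesRel) := by
  set mid : ℝ := (u + v) / 2 with hmid
  set C : ℝ := (v - u) / 2 with hC
  have hCpos : 0 < C := by rw [hC]; linarith
  have h2a : IsAlgebraic ℚ (2 : ℝ) := by exact_mod_cast isAlgebraic_nat 2
  have hmida : IsAlgebraic ℚ mid := (hu.add hv).mul h2a.inv
  have hCa : IsAlgebraic ℚ C := (hv.sub hu).mul h2a.inv
  have humid : u < mid := by rw [hmid]; linarith
  have hmidv : mid < v := by rw [hmid]; linarith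
  -- left half: `x = u + C t`, bad end `u`
  obtain ⟨gl, Pl, Rl, hL, hRl, hcovL⟩ := halfCell hPG ρ hdom P hP hcell huv01 u C 1 hu hCpos hCa
    (Or.inl rfl) (fun t ht => ⟨by nlinarith [ht.1], by nlinarith [ht.2]⟩) u mid hu hmida
    (fun x hx => ⟨hx.1, hx.2.trans hmidv⟩)
    (by rw [affine_image_Ioo_pos u C hCpos]; congr 1; rw [hmid, hC]; ring)
  -- right half: `x = v − C t`, bad end `v`
  obtain ⟨gr, Pr, Rr, hR, hRr, hcovR⟩ := halfCell hPG ρ hdom P hP hcell huv01 v C (-1) hv hCpos hCa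
    (Or.inr rfl) (fun t ht => ⟨by nlinarith [ht.2], by nlinarith [ht.1]⟩) mid v hmida hv
    (fun x hx => ⟨humid.trans hx.1, hx.2⟩)
    (by rw [affine_image_Ioo_neg v C hCpos]; congr 1; rw [hmid, hC]; ring)
  refine ⟨fun b => cond b gl gr, fun b => cond b Pl Pr, fun b => cond b Rl Rr, fun b => ?_, fun b => ?_, ?_⟩
  · cases b <;> assumption
  · cases b <;> assumption
  · have h1 := cut_split ρ hu hmida hv humid hmidv
    have h2 : KZ.of Rl - KZ.of (cut ρ u mid) ∈ AddSubgroup.closure (KZ.domainAddRel ∪ KZ.changeOfVariablesRel) :=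
      AddSubgroup.subset_closure (Or.inr hcovL)
    have h3 : KZ.of Rr - KZ.of (cut ρ mid v) ∈ AddSubgroup.closure (KZ.domainAddRel ∪ KZ.changeOfVariablesRel) :=
      AddSubgroup.subset_closure (Or.inr hcovR)
    have h := sub_mem (sub_mem h1 h2) h3
    rw [Fintype.sum_bool]
    have he : KZ.of (cut ρ u v) - KZ.of (cut ρ u mid) - KZ.of (cut ρ mid v) - (KZ.of Rl - KZ.of (cut ρ u mid)) -
        (KZ.of Rr - KZ.of (cut ρ mid v)) = KZ.of (cut ρ u v) - (KZ.of Rl + KZ.of Rr) := by abel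
    rwa [he] at h

/-! ## The stub modulo the Puiseux germ -/

/-- **`stub_arcSymbols` GRANTED THE NORMALISED PUISEUX GERM** (`hPG` = the registered statement
`CurvePeriodsTransfer.stub_puiseuxGerm` of the sibling crux stmt-11129): a representation on `(0,1)`
is, modulo `M₁`, a finite algebraic combination of real realisations of period symbols of curve type
along `ℚ`-semialgebraic paths, with the same value. Cut at the break points of the integrand and the
mid-points of the cells (1a), flatten the half-cells (rule 2, Puiseux), and assemble
(`ArcSymbols.arcSymbols_of_pieces`). [cite: HuberWustholz2022, Prop. 12.5] -/
theorem arcSymbols_of_germ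
    (hPG : ∀ (f : ℝ → ℝ) (a δ : ℝ), IsAlgebraic ℚ a → 0 < δ →
      IsSemialgebraicFunOn ℚ {z : Fin 1 → ℝ | z 0 ∈ Set.Ioo a (a + δ)} (fun z => f (z 0)) →
      ∃ (q : ℕ) (m : ℤ) (h : ℝ → ℝ), 0 < q ∧ AnalyticAt ℝ h 0 ∧ (∀ n, IsAlgebraic ℚ (iteratedDeriv n h 0)) ∧
        (h 0 ≠ 0 ∨ ∀ s, h s = 0) ∧ ∀ᶠ s in 𝓝[>] (0 : ℝ), f (a + s ^ q) = s ^ m * h s) :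
    ∀ ρ : KZ.IntegralRep 1, ρ.domain = {z | z 0 ∈ Set.Ioo (0 : ℝ) 1} →
    ∃ (C : PeriodSymbol →₀ ℂ) (R : PeriodSymbol → KZ.IntegralRep 1), (∀ s, IsAlgebraic ℚ (C s)) ∧
      (∀ s ∈ C.support, IsSemialgebraicMapOn ℚ {z : Fin 1 → ℝ | z 0 ∈ Set.Icc (0 : ℝ) 1}
        (fun z => Fin.append (fun i => (s.γ.toFun (z 0) i).re) (fun i => (s.γ.toFun (z 0) i).im))) ∧
      (∀ s ∈ C.support, (R s).domain = {z | z 0 ∈ Set.Ioo (0 : ℝ) 1} ∧ ∀ z ∈ (R s).domain, (R s).integrand z =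
        (C s * ∑ i, MvPolynomial.eval (s.γ.toFun (z 0)) (s.ω i) * deriv (fun u => s.γ.toFun u i) (z 0)).re) ∧
      evalCombination C = ((ρ.value : ℝ) : ℂ) ∧ KZ.of ρ - ∑ s ∈ C.support, KZ.of (R s) ∈ M₁ := by
  intro ρ hdom
  classical
  -- the integrand as a function of one variable
  set h : ℝ → ℝ := fun t => ρ.integrand fun _ => t with hh
  have hhz : ∀ z : Fin 1 → ℝ, ρ.integrand z = h (z 0) := fun z => by
    rw [hh]
    show ρ.integrand z = ρ.integrand fun _ => z 0
    congr 1
    funext i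
    rw [Fin.fin_one_eq_zero i]
  have hsa_h : IsSemialgebraicFunOn ℚ {z : Fin 1 → ℝ | z 0 ∈ Set.Ioo (0 : ℝ) 1} (fun z => h (z 0)) := by
    have h1 := ρ.isSemialgebraicFunOn_integrand
    rw [hdom] at h1
    exact h1.congr fun z _ => hhz z
  -- break points and cells
  obtain ⟨B, hB01, hBalg, hBcell⟩ := stub_saPieceFacts.2 h 0 1 zero_lt_one hsa_h
  obtain ⟨cells, hcells, hsum⟩ := exists_cells ρ B hBalg 0 1 isAlgebraic_zero isAlgebraic_one zero_lt_one
    fun e he => hB01 he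
  -- the two standard pieces of every cell
  have hex : ∀ c : ↥cells, ∃ (g : Bool → ℝ → ℝ) (G : Bool → MvPolynomial (Fin 2) ℝ) (R : Bool → KZ.IntegralRep 1),
      (∀ b, (∀ e, IsAlgebraic ℚ ((G b).coeff e)) ∧ (∀ s ∈ Set.Icc (0 : ℝ) 1, AnalyticAt ℝ (g b) s) ∧
        (∀ n, IsAlgebraic ℚ (iteratedDeriv n (g b) 0)) ∧ IsAlgebraic ℚ ((g b) 1) ∧
        IsSemialgebraicFunOn ℚ {z : Fin 1 → ℝ | z 0 ∈ Set.Icc (0 : ℝ) 1} (fun z => (g b) (z 0)) ∧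
        (∀ s ∈ Set.Icc (0 : ℝ) 1, MvPolynomial.eval ![s, (g b) s] (G b) = 0) ∧
        (∀ s ∈ Set.Ioc (0 : ℝ) 1, MvPolynomial.eval ![s, (g b) s] (MvPolynomial.pderiv 1 (G b)) ≠ 0)) ∧
      (∀ b, (R b).domain = {z : Fin 1 → ℝ | z 0 ∈ Set.Ioo (0 : ℝ) 1} ∧
        ∀ z ∈ (R b).domain, (R b).integrand z = g b (z 0)) ∧
      KZ.of (cut ρ c.1.1 c.1.2) - ∑ b, KZ.of (R b) ∈
        AddSubgroup.closure (KZ.domainAddRel ∪ KZ.changeOfVariablesRel) := by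
    rintro ⟨c, hc⟩
    obtain ⟨h0, hlt, h1, hua, hva, hu, hv, hno⟩ := hcells c hc
    obtain ⟨P, hP, hPcell⟩ := hBcell c.1 c.2 hlt hu hv hno
    exact cell_pieces hPG ρ hdom P hP hua hva hlt (fun x hx => ⟨h0.trans_lt hx.1, hx.2.trans_le h1⟩) hPcell
  choose g G R hSP hR hrel using hex
  -- assembly over the index `↥cells × Bool`
  have hrel' : KZ.of ρ - ∑ i : ↥cells × Bool, KZ.of (R i.1 i.2) ∈
      AddSubgroup.closure (KZ.domainAddRel ∪ KZ.changeOfVariablesRel) := by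
    have h1 := of_sub_of_cut_mem ρ isAlgebraic_zero isAlgebraic_one hdom
    have h3 : ∑ c : ↥cells, (KZ.of (cut ρ c.1.1 c.1.2) - ∑ b, KZ.of (R c b)) ∈
        AddSubgroup.closure (KZ.domainAddRel ∪ KZ.changeOfVariablesRel) := sum_mem fun c _ => hrel c
    rw [Finset.sum_sub_distrib] at h3
    have h4 : ∑ c : ↥cells, KZ.of (cut ρ c.1.1 c.1.2) = ∑ c ∈ cells, KZ.of (cut ρ c.1 c.2) :=
      Finset.sum_coe_sort cells (fun c => KZ.of (cut ρ c.1 c.2))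
    rw [h4] at h3
    have h5 : ∑ i : ↥cells × Bool, KZ.of (R i.1 i.2) = ∑ c : ↥cells, ∑ b, KZ.of (R c b) :=
      Fintype.sum_prod_type _
    have h := add_mem (add_mem h1 hsum) h3
    rw [h5]
    have he : KZ.of ρ - KZ.of (cut ρ 0 1) + (KZ.of (cut ρ 0 1) - ∑ c ∈ cells, KZ.of (cut ρ c.1 c.2)) +
        (∑ c ∈ cells, KZ.of (cut ρ c.1 c.2) - ∑ c : ↥cells, ∑ b, KZ.of (R c b)) =
        KZ.of ρ - ∑ c : ↥cells, ∑ b, KZ.of (R c b) := by abel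
    rwa [he] at h
  exact arcSymbols_of_pieces ρ (fun i : ↥cells × Bool => g i.1 i.2) (fun i => G i.1 i.2)
    (fun i => R i.1 i.2) (fun i => hSP i.1 i.2) (fun i => hR i.1 i.2) hrel'

end ArcSymbols

/-- **Registered anchor `helper_arcSymbols_7`** (the stub `stub_arcSymbols` granted the normalised
Puiseux germ of one-sided `ℚ`-semialgebraic germs, = `CurvePeriodsTransfer.stub_puiseuxGerm`).
[cite: HuberWustholz2022, Prop. 12.5] -/
theorem helper_arcSymbols_7 : (∀ (f : ℝ → ℝ) (a δ : ℝ), IsAlgebraic ℚ a → 0 < δ → IsSemialgebraicFunOn ℚ {z : Fin 1 → ℝ | z 0 ∈ Set.Ioo a (a + δ)} (fun z => f (z 0)) → ∃ (q : ℕ) (m : ℤ) (h : ℝ → ℝ), 0 < q ∧ AnalyticAt ℝ h 0 ∧ (∀ n, IsAlgebraic ℚ (iteratedDeriv n h 0)) ∧ (h 0 ≠ 0 ∨ ∀ s, h s = 0) ∧ ∀ᶠ s in 𝓝[>] (0 : ℝ), f (a + s ^ q) = s ^ m * h s) → ∀ ρ : KZ.IntegralRep 1, ρ.domain = {z | z 0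 ∈ Set.Ioo (0 : ℝ) 1} → ContDiffOn ℝ ((⊤ : ℕ∞) : WithTop ℕ∞) (fun t : ℝ => ρ.integrand (fun _ : Fin 1 => t)) (Set.Ioo (0 : ℝ) 1) → ∃ (C : PeriodSymbol →₀ ℂ) (R : PeriodSymbol → KZ.IntegralRep 1), (∀ s, IsAlgebraic ℚ (C s)) ∧ (∀ s ∈ C.support, IsSemialgebraicMapOn ℚ {z : Fin 1 → ℝ | z 0 ∈ Set.Icc (0 : ℝ) 1} (fun z => Fin.append (fun i => (s.γ.toFun (z 0) i).re) (fun i => (s.γ.toFun (z 0) i).im))) ∧ (∀ s ∈ C.support, (R s).domain = {z | z 0 ∈ Set.Ioo (0 : ℝ) 1} ∧ ∀ z ∈ (R s).domain, (R s).integrand z = (C s * ∑ i, MvPolynomial.eval (s.γ.toFun (z 0)) (s.ω i) * deriv (fun u => s.γ.toFun u i) (z 0)).re) ∧ evalCombination C = ((ρ.value : ℝ) : ℂ) ∧ KZ.of ρ - ∑ s ∈ C.support, KZ.of (R s) ∈ M₁ :=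
  fun hPG ρ hdom _ => ArcSymbols.arcSymbols_of_germ hPG ρ hdom

end Summit.KontsevichZagierPeriods.SymplecticScissors.RealOnePeriodRelations

end
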